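import Summits.Ventures.CertifiedManyBodySolver.Certificates.HubbardSquare_polarizedSeaCaps_cs3atlasA
import Summits.Ventures.CertifiedManyBodySolver.Certificates.HubbardSquare_polarizedSeaCaps_cs3atlasB
import HarnessLib
import HarnessLib.Audit

/-!
# Ventures/CertifiedManyBodySolver — Observables/PhaseSeparationExclusionStripPolCaps.lean: the sr-mbsolver CONSTANT POLARISED-SEA CAPS at fillings `7/10`, `3/4`, `4/5`, `17/20`
# on the hole strips `t′ ∈ [−3/10,−1/5] ∣ [−1/5,−1/10] ∣ [−1/10,0]` in the CAP-PLANE / CELL shape of the competing-order laws (hubbard-downfold-unc-2 g36, filling direction)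

HONEST FRAMING: a transport (re-packaging) file, zero compute, no definition, no claim node, no number of record. PURPOSE (cell `pub/hubbard-downfold`, MO-S1 ↔ S2 seam «box ↦ one
word», filling lane «chords, convexity in n»): every `(≤ n₁ ∣ ≥ 1)` competing-order law of this seat / hubbard-box-p3 reads its CAP slot as
`∀ s ∈ [s₁,s₂], ∀ U ∈ [U₁,U₂], e(1, s, U, a·n₁ + b·1) ≤ c₀ + c_s·s + c₁·U` at the witness filling `a·n₁ + b = n_b`, and the g35 FILLING-CONVEXITY floor
(`dilute_floor_of_halfFloor_of_cap`) reads an UPPER bound `e(1, s, U₀, n₀) ≤ c₀ + c_s·s + c₁·U₀` at a filling `n₀ > 1/2`. Up to now those slots held the WS597 filling-`3/4`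
witness-split plane (`c₁ = +0.0288`: loose at `U ≥ 12`) or hubbard-box-p3's affine kernel polarised caps at fillings `1/2`, `5/8` (`polHalf_*`, `pol5o8_*`). The tree ALSO holds
sr-mbsolver's PREMISE-FREE CONSTANT polarised-sea caps `polCap_cs3S{3,4,5}_n0{700,750,800,850,…}` (`Certificates/HubbardSquare_polarizedSeaCaps_cs3atlas{A,B}.lean`, kernel
`decide` on pocket tables via `energyDensityTT'_le_const_of_polarizedPlaneCheck`; [cite: BachLiebSolovej1994, eq. (2c.36)]) at the fillings `7/10 ∣ 3/4 ∣ 4/5 ∣ 17/20` — written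
for the M3 TREE-CAP registry rows and cited by no competing-order word so far. At `U ≥ 12` on the La-214 strip they are the BETTER word caps: the chord from the dilute floor at
`n₁ ≤ 1/2` to the `n = 1` column passes `0.10–0.16·t` higher at filling `3/4` than at `5/8` while the polarised sea rises by only `≈ 0.10·t`, and the WS597 plane at `U = 12∣14`
reads `−0.69∣−0.63` at `t′ = −3/10` against the constant `−0.7337` here. CONSEQUENCE (exact rationals, `work/survey36b.py` of this seat, with the #674 quarter column of
`PhaseSeparationExclusionQuarterConvexFloorB.lean`): `T = 0` margins on `Q = [−1/4,−1/5] × [12,14] ∣ [14,16] ∣ [12,16]` `(≤1/2∣≥1)` `0.0082 ∣ 0.0091 ∣ 0.0082 → 0.0522 ∣ 0.0540 ∣ 0.0522`,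
`(≤9/20∣≥1)` `0.0130 ∣ 0.0116 ∣ 0.0130 → 0.0580 ∣ 0.0599 ∣ 0.0580`; `D = [−3/10,−1/4] × [12,16]` `0.0429 → 0.0666 ∣ 0.0546 → 0.0759`; the one-piece cells `[10,16]` turn positive
(`Q: −0.0085 → +0.0242 ∣ −0.0005 → +0.0306`); `[−1/5,−1/8] × [14,16]` turns positive (`+0.0042 ∣ +0.0045`). This file only re-states each constant cap (i) with the affine right-hand
side `q + 0·s + 0·U` the laws unify against (`polS?n0???`) and (ii) in the cell form with the density slot written `a·n₁ + b·n₂` (`polS?n0???_tcap_on_cell`), exactly as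
hubbard-box-p3's `pol5o8_m30m20_tcap_on_cell`.
WHAT THIS IS NOT: a certificate; a new bound (each theorem is a one-line instance of the cited kernel theorem); a cell word by itself; nothing at `t′ > 0` or `t′ < −3/10`;
not a statement about magnetism (the polarised sea is a trial state, not a claim about the ground state) or superconductivity.

Cell `pub/hubbard-downfold` (MO-S1 ↔ S2 seam «box ↦ one word», filling lane), seat `hubbard-downfold-unc-2` (g36, `prover-hubbard-downfold-unc-2-g36-0`).
[cite: BachLiebSolovej1994, eq. (2c.36)] [cite: Ruelle1969, §3.3]
-/

noncomputable section

namespace Summit.Ventures.CertifiedManyBodySolver.Observables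

open Summit.Ventures.CertifiedManyBodySolver.Certificates
open Literature.MathematicalPhysics.QuantumLattice Literature.MathematicalPhysics.QuantumLattice.ThermodynamicLimit Set

/-- **Constant polarised-sea cap at filling `7 / 10` on `t′ ∈ [-3 / 10, -1 / 5]`, affine right-hand side** (PROVED kernel theorem `polCap_cs3S3_n0700`, `U`-independent, no claim
node): for every `U ≥ 0` and every such `s`, `e(1, s, U, 7 / 10) ≤ -0.7903676196 (+ 0·s + 0·U)`. [cite: BachLiebSolovej1994, eq. (2c.36)] -/
theorem polS3n0700 {U : ℝ} (hU : 0 ≤ U) {s : ℝ} (h₁ : (-3 / 10 : ℝ) ≤ s) (h₂ : s ≤ -1 / 5) :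
    energyDensityTT' 1 s U (7 / 10) ≤ ((-1975919049/2500000000 : ℚ) : ℝ) + ((0 : ℚ) : ℝ) * s + ((0 : ℚ) : ℝ) * U := by
  have h := polCap_cs3S3_n0700 hU h₁ h₂
  push_cast at h ⊢
  linarith [h]

/-- **Cell form** of `polS3n0700` (the `hC` slot of the column-form PS-exclusion laws, `c_s = c₁ = 0`): on any cell `[s₁, s₂] × [U₁, U₂]` with `-3 / 10 ≤ s₁`, `s₂ ≤ -1 / 5`,
`U₁ ≥ 0`, and the density slot written `a·n₁ + b·n₂ = 7 / 10`. [cite: BachLiebSolovej1994, eq. (2c.36)] [cite: Ruelle1969, §3.3] -/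
theorem polS3n0700_tcap_on_cell {s₁ s₂ U₁ U₂ a n₁ b n₂ : ℝ} (hs₁ : (-3 / 10 : ℝ) ≤ s₁) (hs₂ : s₂ ≤ -1 / 5) (hU₁ : 0 ≤ U₁)
    (hab : a * n₁ + b * n₂ = 7 / 10) :
    ∀ s ∈ Icc s₁ s₂, ∀ U ∈ Icc U₁ U₂, energyDensityTT' 1 s U (a * n₁ + b * n₂) ≤ ((-1975919049/2500000000 : ℚ) : ℝ) + ((0 : ℚ) : ℝ) * s + ((0 : ℚ) : ℝ) * U := by
  intro s hs U hU
  rw [hab]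
  exact polS3n0700 (hU₁.trans hU.1) (hs₁.trans hs.1) (hs.2.trans hs₂)

/-- **Constant polarised-sea cap at filling `3 / 4` on `t′ ∈ [-3 / 10, -1 / 5]`, affine right-hand side** (PROVED kernel theorem `polCap_cs3S3_n0750`, `U`-independent, no claim
node): for every `U ≥ 0` and every such `s`, `e(1, s, U, 3 / 4) ≤ -0.7336528871 (+ 0·s + 0·U)`. [cite: BachLiebSolovej1994, eq. (2c.36)] -/
theorem polS3n0750 {U : ℝ} (hU : 0 ≤ U) {s : ℝ} (h₁ : (-3 / 10 : ℝ) ≤ s) (h₂ : s ≤ -1 / 5) :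
    energyDensityTT' 1 s U (3 / 4) ≤ ((-7336528871/10000000000 : ℚ) : ℝ) + ((0 : ℚ) : ℝ) * s + ((0 : ℚ) : ℝ) * U := by
  have h := polCap_cs3S3_n0750 hU h₁ h₂
  push_cast at h ⊢
  linarith [h]

/-- **Cell form** of `polS3n0750` (the `hC` slot of the column-form PS-exclusion laws, `c_s = c₁ = 0`): on any cell `[s₁, s₂] × [U₁, U₂]` with `-3 / 10 ≤ s₁`, `s₂ ≤ -1 / 5`,
`U₁ ≥ 0`, and the density slot written `a·n₁ + b·n₂ = 3 / 4`. [cite: BachLiebSolovej1994, eq. (2c.36)] [cite: Ruelle1969, §3.3] -/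
theorem polS3n0750_tcap_on_cell {s₁ s₂ U₁ U₂ a n₁ b n₂ : ℝ} (hs₁ : (-3 / 10 : ℝ) ≤ s₁) (hs₂ : s₂ ≤ -1 / 5) (hU₁ : 0 ≤ U₁)
    (hab : a * n₁ + b * n₂ = 3 / 4) :
    ∀ s ∈ Icc s₁ s₂, ∀ U ∈ Icc U₁ U₂, energyDensityTT' 1 s U (a * n₁ + b * n₂) ≤ ((-7336528871/10000000000 : ℚ) : ℝ) + ((0 : ℚ) : ℝ) * s + ((0 : ℚ) : ℝ) * U := by
  intro s hs U hU
  rw [hab]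
  exact polS3n0750 (hU₁.trans hU.1) (hs₁.trans hs.1) (hs.2.trans hs₂)

/-- **Constant polarised-sea cap at filling `17 / 20` on `t′ ∈ [-3 / 10, -1 / 5]`, affine right-hand side** (PROVED kernel theorem `polCap_cs3S3_n0850`, `U`-independent, no claim
node): for every `U ≥ 0` and every such `s`, `e(1, s, U, 17 / 20) ≤ -0.5402517454 (+ 0·s + 0·U)`. [cite: BachLiebSolovej1994, eq. (2c.36)] -/
theorem polS3n0850 {U : ℝ} (hU : 0 ≤ U) {s : ℝ} (h₁ : (-3 / 10 : ℝ) ≤ s) (h₂ : s ≤ -1 / 5) :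
    energyDensityTT' 1 s U (17 / 20) ≤ ((-2701258727/5000000000 : ℚ) : ℝ) + ((0 : ℚ) : ℝ) * s + ((0 : ℚ) : ℝ) * U := by
  have h := polCap_cs3S3_n0850 hU h₁ h₂
  push_cast at h ⊢
  linarith [h]

/-- **Cell form** of `polS3n0850` (the `hC` slot of the column-form PS-exclusion laws, `c_s = c₁ = 0`): on any cell `[s₁, s₂] × [U₁, U₂]` with `-3 / 10 ≤ s₁`, `s₂ ≤ -1 / 5`,
`U₁ ≥ 0`, and the density slot written `a·n₁ + b·n₂ = 17 / 20`. [cite: BachLiebSolovej1994, eq. (2c.36)] [cite: Ruelle1969, §3.3] -/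
theorem polS3n0850_tcap_on_cell {s₁ s₂ U₁ U₂ a n₁ b n₂ : ℝ} (hs₁ : (-3 / 10 : ℝ) ≤ s₁) (hs₂ : s₂ ≤ -1 / 5) (hU₁ : 0 ≤ U₁)
    (hab : a * n₁ + b * n₂ = 17 / 20) :
    ∀ s ∈ Icc s₁ s₂, ∀ U ∈ Icc U₁ U₂, energyDensityTT' 1 s U (a * n₁ + b * n₂) ≤ ((-2701258727/5000000000 : ℚ) : ℝ) + ((0 : ℚ) : ℝ) * s + ((0 : ℚ) : ℝ) * U := by
  intro s hs U hU
  rw [hab]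
  exact polS3n0850 (hU₁.trans hU.1) (hs₁.trans hs.1) (hs.2.trans hs₂)

/-- **Constant polarised-sea cap at filling `7 / 10` on `t′ ∈ [-1 / 5, -1 / 10]`, affine right-hand side** (PROVED kernel theorem `polCap_cs3S4_n0700`, `U`-independent, no claim
node): for every `U ≥ 0` and every such `s`, `e(1, s, U, 7 / 10) ≤ -0.7539230872 (+ 0·s + 0·U)`. [cite: BachLiebSolovej1994, eq. (2c.36)] -/
theorem polS4n0700 {U : ℝ} (hU : 0 ≤ U) {s : ℝ} (h₁ : (-1 / 5 : ℝ) ≤ s) (h₂ : s ≤ -1 / 10) :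
    energyDensityTT' 1 s U (7 / 10) ≤ ((-942403859/1250000000 : ℚ) : ℝ) + ((0 : ℚ) : ℝ) * s + ((0 : ℚ) : ℝ) * U := by
  have h := polCap_cs3S4_n0700 hU h₁ h₂
  push_cast at h ⊢
  linarith [h]

/-- **Cell form** of `polS4n0700` (the `hC` slot of the column-form PS-exclusion laws, `c_s = c₁ = 0`): on any cell `[s₁, s₂] × [U₁, U₂]` with `-1 / 5 ≤ s₁`, `s₂ ≤ -1 / 10`,
`U₁ ≥ 0`, and the density slot written `a·n₁ + b·n₂ = 7 / 10`. [cite: BachLiebSolovej1994, eq. (2c.36)] [cite: Ruelle1969, §3.3] -/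
theorem polS4n0700_tcap_on_cell {s₁ s₂ U₁ U₂ a n₁ b n₂ : ℝ} (hs₁ : (-1 / 5 : ℝ) ≤ s₁) (hs₂ : s₂ ≤ -1 / 10) (hU₁ : 0 ≤ U₁)
    (hab : a * n₁ + b * n₂ = 7 / 10) :
    ∀ s ∈ Icc s₁ s₂, ∀ U ∈ Icc U₁ U₂, energyDensityTT' 1 s U (a * n₁ + b * n₂) ≤ ((-942403859/1250000000 : ℚ) : ℝ) + ((0 : ℚ) : ℝ) * s + ((0 : ℚ) : ℝ) * U := by
  intro s hs U hU
  rw [hab]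
  exact polS4n0700 (hU₁.trans hU.1) (hs₁.trans hs.1) (hs.2.trans hs₂)

/-- **Constant polarised-sea cap at filling `3 / 4` on `t′ ∈ [-1 / 5, -1 / 10]`, affine right-hand side** (PROVED kernel theorem `polCap_cs3S4_n0750`, `U`-independent, no claim
node): for every `U ≥ 0` and every such `s`, `e(1, s, U, 3 / 4) ≤ -0.6945926230 (+ 0·s + 0·U)`. [cite: BachLiebSolovej1994, eq. (2c.36)] -/
theorem polS4n0750 {U : ℝ} (hU : 0 ≤ U) {s : ℝ} (h₁ : (-1 / 5 : ℝ) ≤ s) (h₂ : s ≤ -1 / 10) :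
    energyDensityTT' 1 s U (3 / 4) ≤ ((-694592623/1000000000 : ℚ) : ℝ) + ((0 : ℚ) : ℝ) * s + ((0 : ℚ) : ℝ) * U := by
  have h := polCap_cs3S4_n0750 hU h₁ h₂
  push_cast at h ⊢
  linarith [h]

/-- **Cell form** of `polS4n0750` (the `hC` slot of the column-form PS-exclusion laws, `c_s = c₁ = 0`): on any cell `[s₁, s₂] × [U₁, U₂]` with `-1 / 5 ≤ s₁`, `s₂ ≤ -1 / 10`,
`U₁ ≥ 0`, and the density slot written `a·n₁ + b·n₂ = 3 / 4`. [cite: BachLiebSolovej1994, eq. (2c.36)] [cite: Ruelle1969, §3.3] -/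
theorem polS4n0750_tcap_on_cell {s₁ s₂ U₁ U₂ a n₁ b n₂ : ℝ} (hs₁ : (-1 / 5 : ℝ) ≤ s₁) (hs₂ : s₂ ≤ -1 / 10) (hU₁ : 0 ≤ U₁)
    (hab : a * n₁ + b * n₂ = 3 / 4) :
    ∀ s ∈ Icc s₁ s₂, ∀ U ∈ Icc U₁ U₂, energyDensityTT' 1 s U (a * n₁ + b * n₂) ≤ ((-694592623/1000000000 : ℚ) : ℝ) + ((0 : ℚ) : ℝ) * s + ((0 : ℚ) : ℝ) * U := by
  intro s hs U hU
  rw [hab]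
  exact polS4n0750 (hU₁.trans hU.1) (hs₁.trans hs.1) (hs.2.trans hs₂)

/-- **Constant polarised-sea cap at filling `7 / 10` on `t′ ∈ [-1 / 10, 0]`, affine right-hand side** (PROVED kernel theorem `polCap_cs3S5_n0700`, `U`-independent, no claim
node): for every `U ≥ 0` and every such `s`, `e(1, s, U, 7 / 10) ≤ -0.7181049057 (+ 0·s + 0·U)`. [cite: BachLiebSolovej1994, eq. (2c.36)] -/
theorem polS5n0700 {U : ℝ} (hU : 0 ≤ U) {s : ℝ} (h₁ : (-1 / 10 : ℝ) ≤ s) (h₂ : s ≤ 0) :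
    energyDensityTT' 1 s U (7 / 10) ≤ ((-7181049057/10000000000 : ℚ) : ℝ) + ((0 : ℚ) : ℝ) * s + ((0 : ℚ) : ℝ) * U := by
  have h := polCap_cs3S5_n0700 hU h₁ h₂
  push_cast at h ⊢
  linarith [h]

/-- **Cell form** of `polS5n0700` (the `hC` slot of the column-form PS-exclusion laws, `c_s = c₁ = 0`): on any cell `[s₁, s₂] × [U₁, U₂]` with `-1 / 10 ≤ s₁`, `s₂ ≤ 0`,
`U₁ ≥ 0`, and the density slot written `a·n₁ + b·n₂ = 7 / 10`. [cite: BachLiebSolovej1994, eq. (2c.36)] [cite: Ruelle1969, §3.3] -/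
theorem polS5n0700_tcap_on_cell {s₁ s₂ U₁ U₂ a n₁ b n₂ : ℝ} (hs₁ : (-1 / 10 : ℝ) ≤ s₁) (hs₂ : s₂ ≤ 0) (hU₁ : 0 ≤ U₁)
    (hab : a * n₁ + b * n₂ = 7 / 10) :
    ∀ s ∈ Icc s₁ s₂, ∀ U ∈ Icc U₁ U₂, energyDensityTT' 1 s U (a * n₁ + b * n₂) ≤ ((-7181049057/10000000000 : ℚ) : ℝ) + ((0 : ℚ) : ℝ) * s + ((0 : ℚ) : ℝ) * U := by
  intro s hs U hU
  rw [hab]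
  exact polS5n0700 (hU₁.trans hU.1) (hs₁.trans hs.1) (hs.2.trans hs₂)

/-- **Constant polarised-sea cap at filling `3 / 4` on `t′ ∈ [-1 / 10, 0]`, affine right-hand side** (PROVED kernel theorem `polCap_cs3S5_n0750`, `U`-independent, no claim
node): for every `U ≥ 0` and every such `s`, `e(1, s, U, 3 / 4) ≤ -0.6556424198 (+ 0·s + 0·U)`. [cite: BachLiebSolovej1994, eq. (2c.36)] -/
theorem polS5n0750 {U : ℝ} (hU : 0 ≤ U) {s : ℝ} (h₁ : (-1 / 10 : ℝ) ≤ s) (h₂ : s ≤ 0) :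
    energyDensityTT' 1 s U (3 / 4) ≤ ((-3278212099/5000000000 : ℚ) : ℝ) + ((0 : ℚ) : ℝ) * s + ((0 : ℚ) : ℝ) * U := by
  have h := polCap_cs3S5_n0750 hU h₁ h₂
  push_cast at h ⊢
  linarith [h]

/-- **Cell form** of `polS5n0750` (the `hC` slot of the column-form PS-exclusion laws, `c_s = c₁ = 0`): on any cell `[s₁, s₂] × [U₁, U₂]` with `-1 / 10 ≤ s₁`, `s₂ ≤ 0`,
`U₁ ≥ 0`, and the density slot written `a·n₁ + b·n₂ = 3 / 4`. [cite: BachLiebSolovej1994, eq. (2c.36)] [cite: Ruelle1969, §3.3] -/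
theorem polS5n0750_tcap_on_cell {s₁ s₂ U₁ U₂ a n₁ b n₂ : ℝ} (hs₁ : (-1 / 10 : ℝ) ≤ s₁) (hs₂ : s₂ ≤ 0) (hU₁ : 0 ≤ U₁)
    (hab : a * n₁ + b * n₂ = 3 / 4) :
    ∀ s ∈ Icc s₁ s₂, ∀ U ∈ Icc U₁ U₂, energyDensityTT' 1 s U (a * n₁ + b * n₂) ≤ ((-3278212099/5000000000 : ℚ) : ℝ) + ((0 : ℚ) : ℝ) * s + ((0 : ℚ) : ℝ) * U := by
  intro s hs U hU
  rw [hab]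
  exact polS5n0750 (hU₁.trans hU.1) (hs₁.trans hs.1) (hs.2.trans hs₂)

/-- **Constant polarised-sea cap at filling `4 / 5` on `t′ ∈ [-1 / 10, 0]`, affine right-hand side** (PROVED kernel theorem `polCap_cs3S5_n0800`, `U`-independent, no claim
node): for every `U ≥ 0` and every such `s`, `e(1, s, U, 4 / 5) ≤ -0.5733200569 (+ 0·s + 0·U)`. [cite: BachLiebSolovej1994, eq. (2c.36)] -/
theorem polS5n0800 {U : ℝ} (hU : 0 ≤ U) {s : ℝ} (h₁ : (-1 / 10 : ℝ) ≤ s) (h₂ : s ≤ 0) :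
    energyDensityTT' 1 s U (4 / 5) ≤ ((-5733200569/10000000000 : ℚ) : ℝ) + ((0 : ℚ) : ℝ) * s + ((0 : ℚ) : ℝ) * U := by
  have h := polCap_cs3S5_n0800 hU h₁ h₂
  push_cast at h ⊢
  linarith [h]

/-- **Cell form** of `polS5n0800` (the `hC` slot of the column-form PS-exclusion laws, `c_s = c₁ = 0`): on any cell `[s₁, s₂] × [U₁, U₂]` with `-1 / 10 ≤ s₁`, `s₂ ≤ 0`,
`U₁ ≥ 0`, and the density slot written `a·n₁ + b·n₂ = 4 / 5`. [cite: BachLiebSolovej1994, eq. (2c.36)] [cite: Ruelle1969, §3.3] -/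
theorem polS5n0800_tcap_on_cell {s₁ s₂ U₁ U₂ a n₁ b n₂ : ℝ} (hs₁ : (-1 / 10 : ℝ) ≤ s₁) (hs₂ : s₂ ≤ 0) (hU₁ : 0 ≤ U₁)
    (hab : a * n₁ + b * n₂ = 4 / 5) :
    ∀ s ∈ Icc s₁ s₂, ∀ U ∈ Icc U₁ U₂, energyDensityTT' 1 s U (a * n₁ + b * n₂) ≤ ((-5733200569/10000000000 : ℚ) : ℝ) + ((0 : ℚ) : ℝ) * s + ((0 : ℚ) : ℝ) * U := by
  intro s hs U hU
  rw [hab]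
  exact polS5n0800 (hU₁.trans hU.1) (hs₁.trans hs.1) (hs.2.trans hs₂)

end Summit.Ventures.CertifiedManyBodySolver.Observables

end
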